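import Summits.ResolutionOfSingularities.ResolutionOfSingularities.Theorems.EquisingularLiftEquisingularLiftLinearCentreCharts
import Literature.AlgebraicGeometry.Motives.GeneratingSectionsOfHomAppLE
import Literature.AlgebraicGeometry.Limits.IdealSheafComap
import Mathlib.AlgebraicGeometry.IdealSheaf.Functorial
import HarnessLib

/-!
# `EquisingularLift` (stmt-ResolutionOfSingularities-15660), line `Sketch` v10b — piece (C) of
# `stub_linearCentre_of_blowupModel`: the restricted ideal `I_Λ · 𝒪_H` of the coordinate linear centre along any `j`

[OURS · L1 W4.5b] Helper for the registered stub `stub_linearCentre_of_blowupModel` of the crux `EquisingularLift`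
(skeleton v10b, lead `res-L1-w45b-lead-1`); NOT a statement of any manuscript. AI-produced, weaker than expert review.

Setting (as in `…LinearCentreKill`, `…LinearCentreCharts`): `k` a commutative ring, the coordinate linear subspace
`Λ = V(x_{r+1}, …, x_{r+m}) ⊆ ℙ^{r+m}_k` carried def-free as the kernel ideal sheaf `K = ker (Proj f)` of `Proj` of a
graded homomorphism `f : k[x_0..x_{r+m}] → k[x_0..x_r]` with `f (C a) = C a`, `f x_i = x_i` (`i ≤ r`), `f x_i = 0`
(`i > r`). For ANY morphism `j : H → ℙ^{r+m}_k` this file computes the inverse-image ideal sheaf `K · 𝒪_H = K.comap j`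
on the charts `H_i = j⁻¹ D₊(x_i)`, in terms of the pulled-back coordinate functions
`j^*(x_a/x_i) = GeneratingSections.homRatio j i a ∈ Γ(H, H_i)` of the tree (`ProjectiveOfGeneratingSections`):

* `comap_ker_kill_ideal_preimage` — if `H_i` is affine, `(K · 𝒪_H)(H_i)` is the ideal spanned by the `j^*(x_a/x_i)`,
  `r + 1 ≤ a` (tree: `LinearCentre.ker_projMap_kill_ideal_basicOpen` (Hartshorne II Prop. 5.9), the affine chart
  formula `ideal_comap_preimage` for inverse-image ideal sheaves (Görtz–Wedhorn I Ex. 4.36) and `homRatio_eq_appLE`);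
* `comap_ker_kill_eq_of_charts` — hence `K · 𝒪_H = 𝔞` as soon as, on a family of such charts covering `H`, the chart
  ideals of `𝔞` are spanned by the `j^*(x_a/x_i)`, `r + 1 ≤ a` (Mathlib `IdealSheafData.ext_of_iSup_eq_top`) — the
  interface with the re-embedding pieces (A) Serre generators / (B) closed immersion by sections of the line, which
  produce `j` with exactly these chart ideals on the home charts;
* `not_range_subset_support_of_comap_eq` — for `H` reduced and `𝔞 ≠ 0`, `K · 𝒪_H = 𝔞` forces `j(H) ⊄ V(K) = Λ`
  (the hypothesis `¬ range j ⊆ Supp K` of `stub_linearCentre_lift`).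

References: [Hartshorne1977, II Prop. 5.9, Thm. 7.1 (a)]; [GortzWedhorn2020, Example 4.36].
-/

set_option linter.dupNamespace false -- mandated namespace `Summit.<Summit>.<Problem>` of this single-conjunct summit

noncomputable section

open CategoryTheory CategoryTheory.Limits AlgebraicGeometry TopologicalSpace
open MvPolynomial HomogeneousLocalization
open Literature.AlgebraicGeometry.Resolution
open Literature.AlgebraicGeometry.Motives Literature.AlgebraicGeometry.Motives.Segre
open AlgebraicGeometry.Scheme.IdealSheafData

attribute [local instance] MvPolynomial.gradedAlgebra

namespace Summit.ResolutionOfSingularities.ResolutionOfSingularities.Cruxes.EquisingularLift.StrataSplit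

namespace LinearCentre

universe u

/-! ## The coordinate fractions `x_a / x_i` -/

/-- The dehomogenized variable `x_a / x_i` in the tree's `mk₁` normal form is the coordinate fraction `frac k i a`
of the chart calculus of `ℙ(ι)_k` (both are `x_a / x_i ∈ (k[x]_{(x_i)})₀`). [folklore] -/
theorem mk₁_X_eq_frac (k : Type u) [CommRing k] {ι : Type} (i a : ι) :
    mk₁ (grading ι k) (X_mem k i) 1 (X a) (X_mem k a) = frac k i a := by
  apply HomogeneousLocalization.val_injective
  rw [val_mk₁, val_frac]
  exact Localization.mk_eq_mk_iff.mpr (Localization.r_iff_exists.mpr ⟨1, by simp⟩)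

/-! ## Chart ideals of the inverse image of the linear centre -/

section Charts

variable {k : Type u} [CommRing k] {r m : ℕ}
  (fk : homogeneousSubmodule (Fin (r + m + 1)) k →+*ᵍ homogeneousSubmodule (Fin (r + 1)) k)
  (hfk' : HomogeneousIdeal.irrelevant (homogeneousSubmodule (Fin (r + 1)) k) ≤
    (HomogeneousIdeal.irrelevant (homogeneousSubmodule (Fin (r + m + 1)) k)).map fk)
  (hfkC : ∀ a : k, fk (C a) = C a)
  (hfkX : ∀ i : Fin (r + m + 1), fk (X i) = if h : (i : ℕ) < r + 1 then X ⟨i, h⟩ else 0)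

include hfkC hfkX in
/-- **The inverse image of the linear centre on an affine chart `H_i = j⁻¹ D₊(x_i)`** of ANY morphism
`j : H → ℙ^{r+m}_k`: the ideal `(K · 𝒪_H)(H_i)` is spanned by the pulled-back coordinate functions
`j^*(x_a/x_i) = homRatio j i a`, `r + 1 ≤ a` (for `i > r` one of them is `j^*(x_i/x_i) = 1`: the chart misses the
centre). [cite: GortzWedhorn2020, Example 4.36] [cite: Hartshorne1977, II Prop. 5.9 and Thm. 7.1 (a)] -/
theorem comap_ker_kill_ideal_preimage {H : Scheme.{u}} (j : H ⟶ Proj (grading (Fin (r + m + 1)) k))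
    (i : Fin (r + m + 1)) (hV : IsAffineOpen (j ⁻¹ᵁ Proj.basicOpen (grading (Fin (r + m + 1)) k) (X i))) :
    ((Proj.map fk hfk').ker.comap j).ideal ⟨j ⁻¹ᵁ Proj.basicOpen (grading (Fin (r + m + 1)) k) (X i), hV⟩ =
      Ideal.span (Set.range fun a : {a : Fin (r + m + 1) // r + 1 ≤ (a : ℕ)} =>
        GeneratingSections.homRatio j i a.1) := by
  rw [Literature.AlgebraicGeometry.Limits.ideal_comap_preimage j (Proj.map fk hfk').ker
      ⟨Proj.basicOpen (grading (Fin (r + m + 1)) k) (X i), Proj.isAffineOpen_basicOpen _ (X i) (X_mem k i) one_pos⟩ hV,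
    ker_projMap_kill_ideal_basicOpen fk hfk' hfkC hfkX i, Ideal.map_span, ← Set.range_comp]
  refine congrArg (fun g : {a : Fin (r + m + 1) // r + 1 ≤ (a : ℕ)} →
      Γ(H, j ⁻¹ᵁ Proj.basicOpen (grading (Fin (r + m + 1)) k) (X i)) => Ideal.span (Set.range g))
    (funext fun a => ?_)
  rw [Function.comp_apply, GeneratingSections.homRatio_eq_appLE, Scheme.Hom.appLE_eq_app, mk₁_X_eq_frac]

include hfkC hfkX in
/-- **`K · 𝒪_H = 𝔞` from the charts.** If the charts `H_i = j⁻¹ D₊(x_i)`, `i ∈ S`, are affine and cover `H`, and on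
each of them the ideal of `𝔞` is spanned by the `j^*(x_a/x_i)`, `r + 1 ≤ a`, then the inverse image of the linear
centre along `j` is `𝔞` (ideal sheaves agreeing on an affine open cover are equal). This is the interface of piece (C)
with the re-embedding pieces (A)/(B) of the line. [cite: Hartshorne1977, II Prop. 5.9] -/
theorem comap_ker_kill_eq_of_charts {H : Scheme.{u}} (j : H ⟶ Proj (grading (Fin (r + m + 1)) k))
    (𝔞 : H.IdealSheafData) (S : Set (Fin (r + m + 1)))
    (hV : ∀ i ∈ S, IsAffineOpen (j ⁻¹ᵁ Proj.basicOpen (grading (Fin (r + m + 1)) k) (X i)))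
    (hcov : ⨆ i : S, j ⁻¹ᵁ Proj.basicOpen (grading (Fin (r + m + 1)) k) (X (i : Fin (r + m + 1))) = ⊤)
    (h𝔞 : ∀ (i : Fin (r + m + 1)) (hi : i ∈ S),
      𝔞.ideal ⟨j ⁻¹ᵁ Proj.basicOpen (grading (Fin (r + m + 1)) k) (X i), hV i hi⟩ =
        Ideal.span (Set.range fun a : {a : Fin (r + m + 1) // r + 1 ≤ (a : ℕ)} =>
          GeneratingSections.homRatio j i a.1)) :
    (Proj.map fk hfk').ker.comap j = 𝔞 := by
  refine Scheme.IdealSheafData.ext_of_iSup_eq_top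
    (fun i : S => ⟨j ⁻¹ᵁ Proj.basicOpen (grading (Fin (r + m + 1)) k) (X (i : Fin (r + m + 1))), hV i i.2⟩) hcov
    fun i => ?_
  rw [comap_ker_kill_ideal_preimage fk hfk' hfkC hfkX j i (hV i i.2), h𝔞 i i.2]

end Charts

/-! ## The re-embedded scheme is not inside the centre -/

/-- If `K · 𝒪_H = 𝔞 ≠ 0` for a reduced `H`, then `j(H) ⊄ V(K)` (else `Supp (K · 𝒪_H) = j⁻¹ V(K) = H`, and an ideal
sheaf with full support on a reduced scheme is zero). [folklore] -/
theorem not_range_subset_support_of_comap_eq {H Y : Scheme.{u}} [IsReduced H] (j : H ⟶ Y)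
    {K : Y.IdealSheafData} {𝔞 : H.IdealSheafData} (h : K.comap j = 𝔞) (h𝔞 : 𝔞 ≠ ⊥) :
    ¬ (Set.range j ⊆ (K.support : Set Y)) := by
  intro hsub
  apply h𝔞
  rw [← h, ← Scheme.IdealSheafData.support_eq_top_iff, Scheme.IdealSheafData.support_comap]
  refine le_antisymm le_top fun x _ => ?_
  exact hsub ⟨x, rfl⟩

end LinearCentre

end Summit.ResolutionOfSingularities.ResolutionOfSingularities.Cruxes.EquisingularLift.StrataSplit

end
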